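import Summits.Ventures.HodgeRepro2.T5BergmanCoeffCartan
import Summits.Ventures.HodgeRepro2.T5HaarCircle

/-!
# The two-torus orbital integral of a `K`-finite matrix coefficient of `π_k` (support, seat p1)

In the weight-`k` Bergman model `π_k` of `SU(1,1)` (`k ≥ 2`), the bi-`K`-equivariance of the `K`-finite
coefficients (`T5BergmanCoeffCartan.matrixCoeff_monomial_rot_mul_mul_rot`:
`⟨π_k(rot u · g · rot v) zᵐ, zⁿ⟩_k = u^{−(k+2n)} v^{−(k+2m)} ⟨π_k(g) zᵐ, zⁿ⟩_k`) makes the «two-torus orbital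
integral» of the coefficient against the characters `u ↦ u^p`, `v ↦ v^q` of the two rotation tori explicit:

  `∫_K ∫_K ⟨π_k(rot u · γ · rot v) zᵐ, zⁿ⟩_k · u^p · conj(v^q) du dv = [p = k + 2n] · [q = −(k + 2m)] · ⟨π_k(γ) zᵐ, zⁿ⟩_k`

(`torus_orbital_eq`, against the normalised Haar measure of the circle, `T5HaarCircle.haarCircle`): it is the
coefficient at `γ` itself when the torus characters are the `K`-types of the two vectors (the «weight vectors»),
and `0` otherwise (`torus_orbital_eq_zero_of_ne`); in all cases `‖∫∫ …‖ ≤ ‖⟨π_k(γ) zᵐ, zⁿ⟩_k‖` (`norm_torus_orbital_le`),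
so the orbital integral inherits the decay `≤ C ‖a(γ)‖^{−k}` of the coefficient.

Explicit model only; nothing about the adelic group, the actual tori, or any period.
Blind lane: Mathlib + the HodgeRepro2 prefix only; no sorry; axioms ⊆ {propext, Classical.choice, Quot.sound}.
-/

namespace Summit.Ventures.HodgeRepro2.T7SupportBergmanTorusOrbital

open MeasureTheory
open T5SU11Unimodular T5SU11Fibration T5BergmanMatrixCoeff T5BergmanCoeffCartan T5HaarCircle

variable [MeasurableSpace Circle] [BorelSpace Circle]

omit [MeasurableSpace Circle] [BorelSpace Circle] in
/-- `u⁻¹ ^ N · u ^ p = u ^ (p − N)` on the circle (`u ≠ 0`) -/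
theorem inv_pow_mul_zpow (u : Circle) (N : ℕ) (p : ℤ) :
    ((u : ℂ)⁻¹) ^ N * (u : ℂ) ^ p = (u : ℂ) ^ (p - (N : ℤ)) := by
  have hu : (u : ℂ) ≠ 0 := Circle.coe_ne_zero u
  rw [inv_pow, ← zpow_natCast, ← zpow_neg, ← zpow_add₀ hu]
  congr 1
  ring

/-- the inner integral (over the right torus) -/
theorem inner_integral (k m n : ℕ) (hk : 2 ≤ k) (u : Circle) (γ : SU11) (p q : ℤ) :
    ∫ v : Circle, matrixCoeff k (fun w => w ^ m) (fun w => w ^ n) (rot u * γ * rot v) *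
        ((u : ℂ) ^ p * (starRingEnd ℂ) ((v : ℂ) ^ q)) ∂haarCircle =
      (if (-(k + 2 * m : ℕ) : ℤ) = q then 1 else 0) *
        ((u : ℂ) ^ (p - ((k + 2 * n : ℕ) : ℤ)) * matrixCoeff k (fun w => w ^ m) (fun w => w ^ n) γ) := by
  have e : ∀ v : Circle, matrixCoeff k (fun w => w ^ m) (fun w => w ^ n) (rot u * γ * rot v) *
      ((u : ℂ) ^ p * (starRingEnd ℂ) ((v : ℂ) ^ q)) =
      (((u : ℂ)⁻¹) ^ (k + 2 * n) * (u : ℂ) ^ p * matrixCoeff k (fun w => w ^ m) (fun w => w ^ n) γ) *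
        ((v : ℂ) ^ (-(k + 2 * m : ℕ) : ℤ) * (starRingEnd ℂ) ((v : ℂ) ^ q)) := by
    intro v
    rw [matrixCoeff_monomial_rot_mul_mul_rot k m n hk u v γ]
    have hv : ((v : ℂ)⁻¹) ^ (k + 2 * m) = (v : ℂ) ^ (-(k + 2 * m : ℕ) : ℤ) := by
      rw [inv_pow, ← zpow_natCast, ← zpow_neg]
    rw [hv]
    ring
  simp_rw [e]
  rw [integral_const_mul, integral_zpow_mul_conj_zpow, inv_pow_mul_zpow]
  ring

/-- **the two-torus orbital integral of a `K`-finite coefficient**: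
`∫∫ ⟨π_k(rot u · γ · rot v) zᵐ, zⁿ⟩_k · u^p · conj(v^q) = [p = k + 2n] · [q = −(k + 2m)] · ⟨π_k(γ) zᵐ, zⁿ⟩_k`. -/
theorem torus_orbital_eq (k m n : ℕ) (hk : 2 ≤ k) (γ : SU11) (p q : ℤ) :
    ∫ u : Circle, ∫ v : Circle, matrixCoeff k (fun w => w ^ m) (fun w => w ^ n) (rot u * γ * rot v) *
        ((u : ℂ) ^ p * (starRingEnd ℂ) ((v : ℂ) ^ q)) ∂haarCircle ∂haarCircle =
      (if p = ((k + 2 * n : ℕ) : ℤ) then 1 else 0) * (if (-(k + 2 * m : ℕ) : ℤ) = q then 1 else 0) *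
        matrixCoeff k (fun w => w ^ m) (fun w => w ^ n) γ := by
  simp_rw [inner_integral k m n hk _ γ p q]
  have e : ∀ u : Circle, (if (-(k + 2 * m : ℕ) : ℤ) = q then (1 : ℂ) else 0) *
      ((u : ℂ) ^ (p - ((k + 2 * n : ℕ) : ℤ)) * matrixCoeff k (fun w => w ^ m) (fun w => w ^ n) γ) =
      ((if (-(k + 2 * m : ℕ) : ℤ) = q then (1 : ℂ) else 0) * matrixCoeff k (fun w => w ^ m) (fun w => w ^ n) γ) *
        ((u : ℂ) ^ (p - ((k + 2 * n : ℕ) : ℤ)) * (starRingEnd ℂ) ((u : ℂ) ^ (0 : ℤ))) := by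
    intro u
    simp only [zpow_zero, map_one, mul_one]
    ring
  simp_rw [e]
  rw [integral_const_mul, integral_zpow_mul_conj_zpow]
  simp only [sub_eq_zero]
  ring

/-- the orbital integral vanishes unless the torus characters are the `K`-types of the two vectors -/
theorem torus_orbital_eq_zero_of_ne (k m n : ℕ) (hk : 2 ≤ k) (γ : SU11) (p q : ℤ)
    (h : ¬ (p = ((k + 2 * n : ℕ) : ℤ) ∧ (-(k + 2 * m : ℕ) : ℤ) = q)) :
    ∫ u : Circle, ∫ v : Circle, matrixCoeff k (fun w => w ^ m) (fun w => w ^ n) (rot u * γ * rot v) *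
        ((u : ℂ) ^ p * (starRingEnd ℂ) ((v : ℂ) ^ q)) ∂haarCircle ∂haarCircle = 0 := by
  rw [torus_orbital_eq k m n hk γ p q]
  by_cases hp : p = ((k + 2 * n : ℕ) : ℤ)
  · have hq : ¬ ((-(k + 2 * m : ℕ) : ℤ) = q) := fun hq => h ⟨hp, hq⟩
    rw [if_neg hq]
    ring
  · rw [if_neg hp]
    ring

/-- **the orbital integral is bounded by the coefficient**: `‖∫∫ …‖ ≤ ‖⟨π_k(γ) zᵐ, zⁿ⟩_k‖`. -/
theorem norm_torus_orbital_le (k m n : ℕ) (hk : 2 ≤ k) (γ : SU11) (p q : ℤ) :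
    ‖∫ u : Circle, ∫ v : Circle, matrixCoeff k (fun w => w ^ m) (fun w => w ^ n) (rot u * γ * rot v) *
        ((u : ℂ) ^ p * (starRingEnd ℂ) ((v : ℂ) ^ q)) ∂haarCircle ∂haarCircle‖ ≤
      ‖matrixCoeff k (fun w => w ^ m) (fun w => w ^ n) γ‖ := by
  rw [torus_orbital_eq k m n hk γ p q, norm_mul, norm_mul]
  have h1 : ‖(if p = ((k + 2 * n : ℕ) : ℤ) then (1 : ℂ) else 0)‖ ≤ 1 := by
    split_ifs <;> simp
  have h2 : ‖(if (-(k + 2 * m : ℕ) : ℤ) = q then (1 : ℂ) else 0)‖ ≤ 1 := by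
    split_ifs <;> simp
  calc ‖(if p = ((k + 2 * n : ℕ) : ℤ) then (1 : ℂ) else 0)‖ *
        ‖(if (-(k + 2 * m : ℕ) : ℤ) = q then (1 : ℂ) else 0)‖ *
        ‖matrixCoeff k (fun w => w ^ m) (fun w => w ^ n) γ‖
      ≤ 1 * 1 * ‖matrixCoeff k (fun w => w ^ m) (fun w => w ^ n) γ‖ := by
        gcongr
    _ = ‖matrixCoeff k (fun w => w ^ m) (fun w => w ^ n) γ‖ := by ring

end Summit.Ventures.HodgeRepro2.T7SupportBergmanTorusOrbital
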